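import Summits.KontsevichZagierPeriods.KontsevichZagierPeriods.Theorems.TerasomaMultiplicationReflectionThirdReps
import Summits.KontsevichZagierPeriods.KontsevichZagierPeriods.Theorems.HermiteRigidityGenusTwoCycleTransferPushforwardDimOne

/-!
# `ReflectionThird` (stmt-KontsevichZagierPeriods-12307) — the moves, I

Continuation of `…ReflectionThirdReps.lean`: the first five links of the chain from
`R = [(0,∞), k/(1+u³)]` towards `invSqrtRep = [(-1,1), 1/√(1-x²)]`, each exhibited as ONE element of
the corresponding generator set of `KZ.relations` (`domainAddRel`, `changeOfVariablesRel`,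
`integrandAddRel`) or as a relation (dropping the null point `{1}`):

* `cubeRep_sub_sub_mem`            — `(0,∞) = (0,1) ∪ [1,∞)` (rule 1);
* `cubeRepIci_sub_foldRep_mem`     — `v = 1/u` on `[1,∞)` (rule 2);
* `foldRep_sub_foldRepUnit_mem`    — `(0,1] ⊇ (0,1)` co-null (rule 1);
* `quadRep_sub_sub_mem`            — `k/(v²-v+1) = k/(1+v³) + k v/(1+v³)` (rule 1);
* `quadRep_sub_arcRep_mem`         — `t = (2v-1)/√3` (rule 2).

The last two rule-2 moves (`T = (3t-t³)/(1-3t²)`, `x = T/√(1+T²)`) are in `…ReflectionThirdMovesTwo.lean`.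

References: M. Kontsevich, D. Zagier, *Periods* (2001), §1.2; G. Andrews, R. Askey, R. Roy,
*Special Functions* (1999), §1.2.
-/

noncomputable section

set_option linter.dupNamespace false

open MeasureTheory Set
open Literature.NumberTheory.Transcendental
open Literature.NumberTheory.Transcendental.KZ
open Literature.ModelTheory.ExponentialFields (IsSemialgebraic isSemialgebraic_univ)
open MvPolynomial (aeval X C)
open Literature.NumberTheory.Transcendental.KZreg (unitIoo isSemialgebraic_unitIoo)
open Summit.KontsevichZagierPeriods.KontsevichZagierPeriods.BetaCancellationNegative
  (symIoo isSemialgebraic_symIoo mem_symIoo invSqrtRep invSqrtRep_domain invSqrtRep_integrand_eq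
    isSemialgebraicFunOn_of_eqOn_inv_sqrt volume_setOf_apply_eq_zero)
open Summit.KontsevichZagierPeriods.HermiteRigidity.GenusTwoCycleTransfer
  (hasFDerivAt_fin_one det_smul_id_fin_one)

namespace Summit.KontsevichZagierPeriods.KontsevichZagierPeriods.Theorems.ReflectionThird

/-! ### Preliminaries moved here from the representations file -/

/-- `√3 · √3 = 3`. [folklore] -/
theorem sqrt3_mul_sqrt3 : √3 * √3 = (3:ℝ) := Real.mul_self_sqrt (by norm_num)

/-- `0 < √3`. [folklore] -/
theorem sqrt3_pos : 0 < √3 := Real.sqrt_pos.2 (by norm_num)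

/-- The constant function `√3` is `ℚ`-semialgebraic. [cite: BochnakCosteRoy1998, §2.2] -/
theorem isSemialgebraicFunOn_const_sqrt3 {s : Set (Fin 1 → ℝ)} (hs : IsSemialgebraic ℚ s) :
    IsSemialgebraicFunOn ℚ s (fun _ => √3) :=
  (isSemialgebraicFunOn_const_ofNat hs 3).fun_sqrt

/-- `(0,∞) = (0,1) ∪ [1,∞)`. [folklore] -/
theorem posDom_eq_union : posDom = unitIoo ∪ iciDom := by
  ext x
  simp only [mem_posDom, mem_union, mem_unitIoo', mem_iciDom]
  constructor
  · intro h
    rcases lt_or_ge (x 0) 1 with h1 | h1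
    · exact Or.inl ⟨h, h1⟩
    · exact Or.inr h1
  · rintro (⟨h, -⟩ | h)
    · exact h
    · linarith

/-- `(0,1) ∩ [1,∞) = ∅`. [folklore] -/
theorem unitIoo_inter_iciDom : unitIoo ∩ iciDom = ∅ := by
  ext x
  simp only [mem_inter_iff, mem_unitIoo', mem_iciDom, mem_empty_iff_false, iff_false, not_and,
    not_le]
  exact fun h => h.2

/-- `(0,1] ∖ (0,1) ⊆ {1}` is null. [folklore] -/
theorem volume_iocDom_diff_unitIoo : volume (iocDom \ unitIoo) = 0 := by
  refine measure_mono_null (fun x hx => ?_) (volume_setOf_apply_eq_zero (0 : Fin 1) 1)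
  simp only [mem_sdiff, mem_iocDom, mem_unitIoo', not_and, not_lt] at hx
  simp only [mem_setOf_eq]
  exact le_antisymm hx.1.2 (hx.2 hx.1.1)

/-- Two vectors of `ℝ¹` with the same coordinate are equal. [folklore] -/
theorem eq_of_apply_zero_eq {x y : Fin 1 → ℝ} (h : x 0 = y 0) : x = y := by
  funext i
  rw [Fin.fin_one_eq_zero i]
  exact h

/-- `|det (c • id_{ℝ¹})| = |c|`. [folklore] -/
theorem abs_det_smul_id (c : ℝ) : |(c • ContinuousLinearMap.id ℝ (Fin 1 → ℝ)).det| = |c| := by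
  rw [det_smul_id_fin_one]

/-! ### Move 2 (rule 1, domain): `(0,∞) = (0,1) ∪ [1,∞)` -/

/-- **Move 2**: `[(0,∞), k/(1+u³)] − [(0,1), k/(1+u³)] − [[1,∞), k/(1+u³)]` is ONE
domain-additivity move. [cite: KontsevichZagier2001, §1.2 rule (1)] -/
theorem cubeRep_sub_sub_mem : of cubeRep - of cubeRepUnit - of cubeRepIci ∈ domainAddRel :=
  ⟨1, cubeRep, cubeRepUnit, cubeRepIci, posDom_eq_union, by
    rw [cubeRepUnit_domain, cubeRepIci_domain, unitIoo_inter_iciDom, measure_empty],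
    fun _ _ => rfl, fun _ _ => rfl, rfl⟩

/-! ### Move 3 (rule 2): the fold `v = 1/u` on `[1,∞)` -/

/-- `1/u` maps `[1,∞)` onto `(0,1]`. [folklore] -/
theorem image_invMap_iciDom : invMap '' iciDom = iocDom := by
  ext y
  constructor
  · rintro ⟨x, hx, rfl⟩
    simp only [mem_iciDom] at hx
    simp only [mem_iocDom, invMap]
    exact ⟨inv_pos.2 (by linarith), inv_le_one_of_one_le₀ hx⟩
  · intro hy
    simp only [mem_iocDom] at hy
    refine ⟨fun _ => (y 0)⁻¹, ?_, ?_⟩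
    · simp only [mem_iciDom]
      exact (one_le_inv₀ hy.1).2 hy.2
    · exact eq_of_apply_zero_eq (by simp [invMap])

/-- **Move 3**: `[[1,∞), k/(1+u³)] − [(0,1], k v/(1+v³)]` is ONE change-of-variables move
(`v = 1/u`, `|dv/du| = 1/u²`, `k/(1+u³) = k v/(1+v³) · u^{-2}`). [cite: AndrewsAskeyRoy1999, §1.2] -/
theorem cubeRepIci_sub_foldRep_mem : of cubeRepIci - of foldRep ∈ changeOfVariablesRel := by
  refine ⟨1, cubeRepIci, foldRep, invMap, invMapDeriv, ?_, ?_, ?_, image_invMap_iciDom.symm, ?_, rfl⟩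
  · exact IsSemialgebraicMapOn.of_forall isSemialgebraic_iciDom fun _ =>
      (isSemialgebraicFunOn_coord isSemialgebraic_iciDom).fun_inv
  · intro x hx
    simp only [cubeRepIci_domain, mem_iciDom] at hx
    exact (hasFDerivAt_fin_one (fun u => u⁻¹) _ x (hasDerivAt_inv (by linarith))).hasFDerivWithinAt
  · intro x hx y hy h
    have h0 : (x 0)⁻¹ = (y 0)⁻¹ := congrFun h 0
    exact eq_of_apply_zero_eq (inv_inj.1 h0)
  · intro x hx
    simp only [cubeRepIci_domain, mem_iciDom] at hx
    have hu : (0:ℝ) < x 0 := by linarith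
    have h3 : (0:ℝ) < 1 + x 0 ^ 3 := one_add_cube_pos hu
    rw [invMapDeriv, abs_det_smul_id, abs_neg, abs_of_pos (inv_pos.2 (pow_pos hu 2))]
    simp only [cubeRepIci_integrand, foldRep_integrand, invMap]
    field_simp
    ring

/-! ### Move 4 (rule 1): drop the null point `{1}` -/

/-- **Move 4**: `[(0,1], k v/(1+v³)] − [(0,1), k v/(1+v³)]` is a relation (domain additivity
along `(0,1] = (0,1) ∪ {1}`, the point being null). [cite: KontsevichZagier2001, §1.2 rule (1)] -/
theorem foldRep_sub_foldRepUnit_mem : of foldRep - of foldRepUnit ∈ relations :=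
  foldRep.of_sub_of_restrict_mem_relations isSemialgebraic_unitIoo unitIoo_subset_iocDom
    volume_iocDom_diff_unitIoo

/-! ### Move 5 (rule 1, integrand): partial fractions `1/(1+v³) + v/(1+v³) = 1/(v²-v+1)` -/

/-- **Move 5**: `[(0,1), k/(v²-v+1)] − [(0,1), k/(1+v³)] − [(0,1), k v/(1+v³)]` is ONE
integrand-additivity move (`1 + v³ = (1+v)(v²-v+1)`). [cite: AndrewsAskeyRoy1999, §1.2] -/
theorem quadRep_sub_sub_mem : of quadRep - of cubeRepUnit - of foldRepUnit ∈ integrandAddRel := by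
  refine ⟨1, quadRep, cubeRepUnit, foldRepUnit, rfl, rfl, fun x hx => ?_, rfl⟩
  simp only [quadRep_domain, mem_unitIoo'] at hx
  have h1 : (0:ℝ) < 1 + x 0 ^ 3 := one_add_cube_pos hx.1
  have h2 : (0:ℝ) < x 0 ^ 2 - x 0 + 1 := sq_sub_add_one_pos (x 0)
  rw [Pi.add_apply]
  simp only [quadRep_integrand, cubeRepUnit_integrand, foldRepUnit_integrand]
  rw [← add_div, div_eq_div_iff h2.ne' h1.ne']
  ring

/-! ### Move 6 (rule 2): the affine substitution `t = (2v-1)/√3` -/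

/-- `d/dv (2v-1)√3/3 = 2√3/3`. [folklore] -/
theorem hasDerivAt_aff (v : ℝ) : HasDerivAt (fun s : ℝ => (2 * s - 1) * √3 / 3) (2 * √3 / 3) v := by
  have h : HasDerivAt (fun s : ℝ => (2 * s - 1) * √3 / 3) (2 * 1 * √3 / 3) v :=
    ((((hasDerivAt_id' v).const_mul 2).sub_const 1).mul_const (√3)).div_const 3
  convert h using 1
  ring

/-- `((2v-1)√3/3)² = (2v-1)²/3`. [folklore] -/
theorem aff_sq (v : ℝ) : ((2 * v - 1) * √3 / 3) ^ 2 = (2 * v - 1) ^ 2 / 3 := by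
  rw [div_pow, mul_pow, Real.sq_sqrt (by norm_num : (0:ℝ) ≤ 3)]
  ring

/-- The Jacobian identity of move 6: `k/(v²-v+1) = 3/(1+t²) · 2√3/3` at `t = (2v-1)√3/3`.
[folklore] -/
theorem aff_jacobian (v : ℝ) :
    k3 / (v ^ 2 - v + 1) = 3 / (1 + ((2 * v - 1) * √3 / 3) ^ 2) * (2 * √3 / 3) := by
  rw [aff_sq]
  have h2 : v ^ 2 - v + 1 ≠ 0 := (sq_sub_add_one_pos v).ne'
  have h3 : 1 + (2 * v - 1) ^ 2 / 3 ≠ 0 := by positivity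
  rw [k3, div_mul_eq_mul_div, div_eq_div_iff h2 h3]
  ring

/-- The affine map sends `(0,1)` onto `{3t² < 1}`. [folklore] -/
theorem image_affMap_unitIoo : affMap '' unitIoo = jDom := by
  ext y
  constructor
  · rintro ⟨x, hx, rfl⟩
    simp only [mem_unitIoo'] at hx
    simp only [mem_jDom, affMap, aff_sq]
    nlinarith [hx.1, hx.2]
  · intro hy
    simp only [mem_jDom] at hy
    have hsq : (√3 * y 0) ^ 2 < 1 := by
      rw [mul_pow, Real.sq_sqrt (by norm_num : (0:ℝ) ≤ 3)]
      exact hy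
    have hab := abs_lt.1 (sq_lt_one_iff_abs_lt_one (√3 * y 0) |>.1 hsq)
    refine ⟨fun _ => (1 + √3 * y 0) / 2, ?_, ?_⟩
    · simp only [mem_unitIoo']
      constructor <;> linarith [hab.1, hab.2]
    · refine eq_of_apply_zero_eq ?_
      simp only [affMap]
      have : √3 * √3 = (3:ℝ) := sqrt3_mul_sqrt3
      calc (2 * ((1 + √3 * y 0) / 2) - 1) * √3 / 3 = (√3 * √3) * y 0 / 3 := by ring
        _ = y 0 := by rw [this]; ring

/-- **Move 6**: `[(0,1), k/(v²-v+1)] − [{3t²<1}, 3/(1+t²)]` is ONE change-of-variables move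
(`t = (2v-1)/√3`, `|dt/dv| = 2/√3`, `k/(v²-v+1) = 3/(1+t²) · 2/√3` with `k = 3√3/2`).
[cite: AndrewsAskeyRoy1999, §1.2] -/
theorem quadRep_sub_arcRep_mem : of quadRep - of arcRep ∈ changeOfVariablesRel := by
  refine ⟨1, quadRep, arcRep, affMap, fun _ => affMapDeriv, ?_, ?_, ?_, image_affMap_unitIoo.symm,
    ?_, rfl⟩
  · refine IsSemialgebraicMapOn.of_forall isSemialgebraic_unitIoo fun _ => ?_
    have hX := isSemialgebraicFunOn_coord isSemialgebraic_unitIoo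
    have h1 : IsSemialgebraicFunOn ℚ unitIoo (fun _ => (1:ℝ)) := by
      simpa using isSemialgebraicFunOn_const_natCast isSemialgebraic_unitIoo 1
    have h2 : IsSemialgebraicFunOn ℚ unitIoo (fun _ => (2:ℝ)) :=
      isSemialgebraicFunOn_const_ofNat isSemialgebraic_unitIoo 2
    have h3 : IsSemialgebraicFunOn ℚ unitIoo (fun _ => (3:ℝ)) :=
      isSemialgebraicFunOn_const_ofNat isSemialgebraic_unitIoo 3
    refine ((((h2.fun_mul hX).fun_sub h1).fun_mul (isSemialgebraicFunOn_const_sqrt3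
      isSemialgebraic_unitIoo)).fun_mul h3.fun_inv).congr fun x _ => ?_
    simp only [affMap, div_eq_mul_inv]
  · intro x _
    exact (hasFDerivAt_fin_one (fun s => (2 * s - 1) * √3 / 3) _ x (hasDerivAt_aff (x 0))).hasFDerivWithinAt
  · intro x _ y _ h
    have h0 : (2 * x 0 - 1) * √3 / 3 = (2 * y 0 - 1) * √3 / 3 := congrFun h 0
    have h1 : (2 * x 0 - 1) * √3 = (2 * y 0 - 1) * √3 := by linarith
    have h2 := mul_right_cancel₀ sqrt3_pos.ne' h1
    exact eq_of_apply_zero_eq (by linarith)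
  · intro x _
    have hpos : 0 < 2 * √3 / 3 := div_pos (mul_pos two_pos sqrt3_pos) (by norm_num)
    rw [affMapDeriv, abs_det_smul_id, abs_of_pos hpos]
    simp only [quadRep_integrand, arcRep_integrand, affMap]
    exact aff_jacobian (x 0)

end Summit.KontsevichZagierPeriods.KontsevichZagierPeriods.Theorems.ReflectionThird

end
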